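import Summits.QuantumFields.YangMills.Theorems.OneCertifiedCubeCrossoverCertificateDefs

/-!
# Freezing of Gibbs ratios (Laplace principle, real-ratio form)

Helper file for the frozen-coupling analysis of crux `CrossoverCertificate` (stmt-QuantumFields-16125).
For a probability measure `ν`, a measurable "action" `ψ` bounded below, and a `[0,1]`-valued weight `g` that
VANISHES wherever `ψ < m + δ`, while `ψ < m + δ/2` has positive `ν`-probability, the Gibbs ratio
`(∫ g e^{-β ψ} dν) / (∫ e^{-β ψ} dν)` is at most `e^{-β δ / 2} / ν{ψ < m + δ/2}` for every `β ≥ 0`; in particular it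
is `≤ 1/4` once `β ≥ (2/δ) log (4 / ν{ψ < m + δ/2})`.  This is the elementary mechanism behind "as `β → ∞` the
finite-volume Wilson kernels concentrate on the minimisers of the boundary action".  Pure measure theory; no lattice
object appears.  Everything is proved; no definition is introduced.

References: folklore (zero-temperature limit of finite-volume Gibbs measures); e.g. Georgii, *Gibbs Measures and
Phase Transitions* (2011), Example 6.2.1 (ground-state concentration).
-/

noncomputable section

namespace Summit.QuantumFields.YangMills.Theorems.CrossoverCertificate.Negative

open MeasureTheory Real

variable {Ω : Type} [MeasurableSpace Ω]

/-- Lower bound for the Gibbs normaliser: `∫ e^{-βψ} dν ≥ e^{-β c'} · ν{ψ < c'}` for `β ≥ 0`. [folklore] -/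
theorem exp_mul_measureReal_le_integral_exp (ν : Measure Ω) [IsProbabilityMeasure ν] {ψ : Ω → ℝ}
    (hψ : Measurable ψ) {c : ℝ} (hc : ∀ ω, c ≤ ψ ω) {β : ℝ} (hβ : 0 ≤ β) (c' : ℝ) :
    Real.exp (-β * c') * ν.real {ω | ψ ω < c'} ≤ ∫ ω, Real.exp (-β * ψ ω) ∂ν := by
  have hmeas : MeasurableSet {ω | ψ ω < c'} := measurableSet_lt hψ measurable_const
  have hint : Integrable (fun ω => Real.exp (-β * ψ ω)) ν := by
    refine Integrable.mono' (integrable_const (Real.exp (-β * c))) ?_ (ae_of_all _ fun ω => ?_)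
    · exact (measurable_const.mul hψ).exp.aestronglyMeasurable
    · rw [Real.norm_eq_abs, abs_of_pos (Real.exp_pos _)]
      exact Real.exp_le_exp.2 (by nlinarith [hc ω])
  calc Real.exp (-β * c') * ν.real {ω | ψ ω < c'}
      = ∫ ω, {ω | ψ ω < c'}.indicator (fun _ => Real.exp (-β * c')) ω ∂ν := by
        rw [integral_indicator_const _ hmeas, smul_eq_mul, mul_comm]
    _ ≤ ∫ ω, Real.exp (-β * ψ ω) ∂ν := by
        refine integral_mono_of_nonneg (ae_of_all _ fun ω => ?_) hint (ae_of_all _ fun ω => ?_)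
        · exact Set.indicator_nonneg (fun _ _ => (Real.exp_pos _).le) _
        · by_cases hω : ω ∈ {ω | ψ ω < c'}
          · rw [Set.indicator_of_mem hω]
            exact Real.exp_le_exp.2 (by nlinarith [show ψ ω < c' from hω])
          · rw [Set.indicator_of_notMem hω]
            exact (Real.exp_pos _).le

/-- **Freezing bound for Gibbs ratios.** If `0 ≤ g ≤ 1` vanishes on `{ψ < m + δ}` and `ν{ψ < m + δ/2} > 0`, then
for `β ≥ 0` the ratio `(∫ g e^{-βψ}) / (∫ e^{-βψ})` is at most `e^{-βδ/2} / ν{ψ < m + δ/2}`. [folklore] -/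
theorem gibbsRatio_le (ν : Measure Ω) [IsProbabilityMeasure ν] {ψ g : Ω → ℝ} (hψ : Measurable ψ)
    {c : ℝ} (hc : ∀ ω, c ≤ ψ ω) (hg01 : ∀ ω, 0 ≤ g ω ∧ g ω ≤ 1) {m δ : ℝ}
    (hvanish : ∀ ω, ψ ω < m + δ → g ω = 0) (hpos : 0 < ν.real {ω | ψ ω < m + δ / 2}) {β : ℝ} (hβ : 0 ≤ β) :
    (∫ ω, g ω * Real.exp (-β * ψ ω) ∂ν) / (∫ ω, Real.exp (-β * ψ ω) ∂ν) ≤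
      Real.exp (-β * δ / 2) / ν.real {ω | ψ ω < m + δ / 2} := by
  set p := ν.real {ω | ψ ω < m + δ / 2} with hp
  have hZ : Real.exp (-β * (m + δ / 2)) * p ≤ ∫ ω, Real.exp (-β * ψ ω) ∂ν :=
    exp_mul_measureReal_le_integral_exp ν hψ hc hβ (m + δ / 2)
  have hZpos : 0 < ∫ ω, Real.exp (-β * ψ ω) ∂ν := lt_of_lt_of_le (mul_pos (Real.exp_pos _) hpos) hZ
  -- numerator ≤ e^{-β (m + δ)}
  have hnum : ∫ ω, g ω * Real.exp (-β * ψ ω) ∂ν ≤ Real.exp (-β * (m + δ)) := by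
    have hpt : ∀ ω, g ω * Real.exp (-β * ψ ω) ≤ Real.exp (-β * (m + δ)) := by
      intro ω
      by_cases hω : ψ ω < m + δ
      · rw [hvanish ω hω, zero_mul]; exact (Real.exp_pos _).le
      · push Not at hω
        calc g ω * Real.exp (-β * ψ ω) ≤ 1 * Real.exp (-β * ψ ω) := by
              gcongr; exact (hg01 ω).2
          _ = Real.exp (-β * ψ ω) := one_mul _
          _ ≤ Real.exp (-β * (m + δ)) := Real.exp_le_exp.2 (by nlinarith)
    calc ∫ ω, g ω * Real.exp (-β * ψ ω) ∂ν ≤ ∫ _, Real.exp (-β * (m + δ)) ∂ν :=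
          integral_mono_of_nonneg (ae_of_all _ fun ω => mul_nonneg (hg01 ω).1 (Real.exp_pos _).le)
            (integrable_const _) (ae_of_all _ hpt)
      _ = Real.exp (-β * (m + δ)) := by simp
  calc (∫ ω, g ω * Real.exp (-β * ψ ω) ∂ν) / (∫ ω, Real.exp (-β * ψ ω) ∂ν)
      ≤ Real.exp (-β * (m + δ)) / (Real.exp (-β * (m + δ / 2)) * p) := by
        have hnn : 0 ≤ ∫ ω, g ω * Real.exp (-β * ψ ω) ∂ν :=
          integral_nonneg fun ω => mul_nonneg (hg01 ω).1 (Real.exp_pos _).le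
        calc (∫ ω, g ω * Real.exp (-β * ψ ω) ∂ν) / (∫ ω, Real.exp (-β * ψ ω) ∂ν)
            ≤ (∫ ω, g ω * Real.exp (-β * ψ ω) ∂ν) / (Real.exp (-β * (m + δ / 2)) * p) :=
              div_le_div_of_nonneg_left hnn (mul_pos (Real.exp_pos _) hpos) hZ
          _ ≤ Real.exp (-β * (m + δ)) / (Real.exp (-β * (m + δ / 2)) * p) :=
              div_le_div_of_nonneg_right hnum (mul_pos (Real.exp_pos _) hpos).le
    _ = Real.exp (-β * δ / 2) / p := by
        rw [div_mul_eq_div_div, ← Real.exp_sub]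
        congr 2; ring

/-- **Freezing threshold.** Under the hypotheses of `gibbsRatio_le`, for
`β ≥ max 0 ((2/δ) · log (4 / ν{ψ < m + δ/2}))` (and `δ > 0`) the Gibbs ratio is at most `1/4`. [folklore] -/
theorem gibbsRatio_le_quarter : ∀ {Ω : Type} [MeasurableSpace Ω] (ν : MeasureTheory.Measure Ω) [MeasureTheory.IsProbabilityMeasure ν] {ψ g : Ω → ℝ}, Measurable ψ → ∀ {c : ℝ}, (∀ ω, c ≤ ψ ω) → (∀ ω, 0 ≤ g ω ∧ g ω ≤ 1) → ∀ {m δ : ℝ}, 0 < δ → (∀ ω, ψ ω < m + δ → g ω = 0) → 0 < ν.real {ω | ψ ω < m + δ / 2} → ∀ {β : ℝ}, max 0 (2 / δ * Real.log (4 / ν.real {ω | ψ ω < m + δ / 2})) ≤ β → (∫ ω, g ω * Real.exp (-β * ψ ω) ∂ν) / (∫ ω, Real.exp (-β * ψ ω) ∂ν) ≤ 1 / 4 := by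
  intro Ω _ ν _ ψ g hψ c hc hg01 m δ hδ hvanish hpos β hβ
  set p := ν.real {ω | ψ ω < m + δ / 2} with hp
  have hβ0 : 0 ≤ β := le_trans (le_max_left _ _) hβ
  have hβ1 : 2 / δ * Real.log (4 / p) ≤ β := le_trans (le_max_right _ _) hβ
  refine (gibbsRatio_le ν hψ hc hg01 hvanish hpos hβ0).trans ?_
  -- e^{-βδ/2} ≤ p/4
  have hlog : Real.log (4 / p) ≤ β * δ / 2 := by
    have := mul_le_mul_of_nonneg_right hβ1 (show 0 ≤ δ / 2 by linarith)
    calc Real.log (4 / p) = 2 / δ * Real.log (4 / p) * (δ / 2) := by field_simp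
      _ ≤ β * (δ / 2) := this
      _ = β * δ / 2 := by ring
  have hexp : Real.exp (-β * δ / 2) ≤ p / 4 := by
    have h4p : 0 < 4 / p := by positivity
    calc Real.exp (-β * δ / 2) = (Real.exp (β * δ / 2))⁻¹ := by rw [← Real.exp_neg]; congr 1; ring
      _ ≤ (Real.exp (Real.log (4 / p)))⁻¹ := by
          gcongr
      _ = p / 4 := by rw [Real.exp_log h4p, inv_div]
  calc Real.exp (-β * δ / 2) / p ≤ (p / 4) / p := div_le_div_of_nonneg_right hexp hpos.le
    _ = 1 / 4 := by field_simp

end Summit.QuantumFields.YangMills.Theorems.CrossoverCertificate.Negative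

end
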